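import Summits.QuantumAdvantage.QuantumAdvantage.Theorems.CubicForrelationNearExactIsExactCubicFormCells

/-!
# Crux `CubicForrelation.NearExactIsExact` (stmt-QuantumAdvantage-14043) — the CELLS of an adapted R4 frame

Certificate seat `b2b-cforr-cert` (gen 42).  HONEST FRAMING: kernel-checked bookkeeping (standard axioms), the prefix-`k` / prefix-`5`
analogue of …CubicFormCells (prefix `3`, the R2 frame), to be used after …CubicFormR4Partner (`tpw_R4_partner_frame`: coordinates
`y_a = e₀, v₀..v₃ = e₁..e₄, z = e₅..` with `κ(y) ⊕ κ(y ⊕ e₀) = y₁y₂ ⊕ y₃y₄`) in the R4 half of `E1280-even` (R4-PARTNER.md §1: "cells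
`f_v(z) = κ(0, v, z)` for `v ∈ Z₁₀ = {v₀v₁ + v₂v₃ = 0}`, `wt κ = 768 + 2 Σ_{v ∈ Z₁₀} wt f_v`").  Nothing about `θ₁₂`; NOT summit progress.

Generic prefix `k` (vectors `Fin.append v s`, `v ∈ 𝔽₂ᵏ`, `s ∈ 𝔽₂ᵐ`): `tc5_append_bxor`, `tc5_unit_left`, `tc5_unit_right`, `tc5_append_zero`,
`tc5_card_cells` (`#κ = Σ_v #κ(v,·)`), `tc5_rho_isDegLeFun` (restrictions keep the degree), `tc5_third_rho_unit` (all cells share the cubic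
form on the `s`-coordinates).
Prefix `5` with the R4 frame identity `hD`: `tc5_top_half` (`κ(1,v,s) = κ(0,v,s) ⊕ Q̄(v)`, `Q̄(v) = v₀v₁ ⊕ v₂v₃`), `tc5_card_top_periodic`
(`Q̄(v) = 0`: both halves weigh the same), `tc5_card_top_special` (`Q̄(v) = 1`: the halves weigh `2ᵐ` together), and `tc5_weight` (**main**):
`#κ = 6·2ᵐ + 2·Σ_{v ∈ Z₁₀} #{s : κ(0,v,s)}` with the ten cells of `Z₁₀` listed explicitly.

References: this seat lineage (g37 R4-PARTNER §1); folklore.  Axioms: the standard three.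
-/

set_option linter.dupNamespace false -- D-0017: single-problem summit ⇒ `QuantumAdvantage.QuantumAdvantage` by design

namespace Summit.QuantumAdvantage.QuantumAdvantage.Theorems.CubicForrelation.NearExactIsExact

open Finset
open Literature.Computability.QuantumComplexity
open Literature.Computability.QuantumComplexity.BuzetChailloux (bxor zeroVec bxor_comm bxor_self bxor_zeroVec zeroVec_bxor
  bxor_bxor_cancel_left)
open Summit.QuantumAdvantage.QuantumAdvantage.Theorems.SignedCubicForrelationNotPrBPP (knf_isDegLeFun_comp)

variable {k m : ℕ}

/-! ### Vectors in the coordinates `(v, s)`, `v ∈ 𝔽₂ᵏ`, `s ∈ 𝔽₂ᵐ` -/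

/-- Xor of appended vectors is appended xor (any prefix length). [folklore] -/
theorem tc5_append_bxor (v v' : Fin k → Bool) (s s' : Fin m → Bool) :
    bxor (Fin.append v s) (Fin.append v' s') = Fin.append (bxor v v') (bxor s s') := by
  funext l
  refine Fin.addCases (fun i => ?_) (fun σ => ?_) l
  · simp only [bxor, Fin.append_left]
  · simp only [bxor, Fin.append_right]

/-- The unit vector at a prefix coordinate. [folklore] -/
theorem tc5_unit_left (t : Fin k) :
    (fun l : Fin (k + m) => decide (l = Fin.castAdd m t)) = Fin.append (fun l : Fin k => decide (l = t)) (zeroVec : Fin m → Bool) := by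
  funext l
  refine Fin.addCases (fun i => ?_) (fun σ => ?_) l
  · simp only [Fin.append_left]
    by_cases h : i = t
    · subst h; simp
    · have : Fin.castAdd m i ≠ Fin.castAdd m t := fun e => h (Fin.castAdd_inj.mp e)
      simp [h, this]
  · simp only [Fin.append_right, zeroVec]
    have : Fin.natAdd k σ ≠ Fin.castAdd m t := by
      intro e
      have := congrArg Fin.val e
      simp only [Fin.val_natAdd, Fin.val_castAdd] at this
      omega
    simp [this]

/-- The unit vector at a suffix coordinate. [folklore] -/
theorem tc5_unit_right (σ : Fin m) :
    (fun l : Fin (k + m) => decide (l = Fin.natAdd k σ)) = Fin.append (zeroVec : Fin k → Bool) (fun l : Fin m => decide (l = σ)) := by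
  funext l
  refine Fin.addCases (fun i => ?_) (fun τ => ?_) l
  · simp only [Fin.append_left, zeroVec]
    have : Fin.castAdd m i ≠ Fin.natAdd k σ := by
      intro e
      have := congrArg Fin.val e
      simp only [Fin.val_natAdd, Fin.val_castAdd] at this
      omega
    simp [this]
  · simp only [Fin.append_right]
    by_cases h : τ = σ
    · subst h; simp
    · have : Fin.natAdd k τ ≠ Fin.natAdd k σ := fun e => h (Fin.natAdd_inj k |>.mp e)
      simp [h, this]

/-- `Fin.append 0 0 = 0` (any prefix length). [folklore] -/
theorem tc5_append_zero : Fin.append (zeroVec : Fin k → Bool) (zeroVec : Fin m → Bool) = (zeroVec : Fin (k + m) → Bool) := by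
  funext l
  refine Fin.addCases (fun i => ?_) (fun σ => ?_) l
  · simp only [Fin.append_left, zeroVec]
  · simp only [Fin.append_right, zeroVec]

/-! ### Counting over the cells -/

/-- **Counting by cells** (any `κ`, any prefix length): `#{y : κ y} = Σ_{v ∈ 𝔽₂ᵏ} #{s : κ(v, s)}`. [folklore] -/
theorem tc5_card_cells (κ : (Fin (k + m) → Bool) → Bool) :
    #(univ.filter fun y : Fin (k + m) → Bool => κ y = true) =
      ∑ v : Fin k → Bool, #(univ.filter fun s : Fin m → Bool => κ (Fin.append v s) = true) := by
  classical
  rw [card_filter]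
  rw [← Fintype.sum_equiv (Fin.appendEquiv k m) (fun vs => if κ (Fin.append vs.1 vs.2) = true then 1 else 0)
    (fun y => if κ y = true then 1 else 0) (fun vs => rfl)]
  rw [Fintype.sum_prod_type]
  exact sum_congr rfl fun v _ => (card_filter _ _).symm

/-! ### The restricted functions `ρ_v(s) = κ(v, s)` -/

/-- The coordinates of `s ↦ (v, s)` are affine. [folklore] -/
theorem tc5_append_coord_deg (v : Fin k → Bool) (l : Fin (k + m)) : IsDegLeFun 1 (fun s : Fin m → Bool => Fin.append v s l) := by
  refine Fin.addCases (fun i => ?_) (fun σ => ?_) l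
  · have : (fun s : Fin m → Bool => Fin.append v s (Fin.castAdd m i)) = fun _ => v i := by
      funext s; exact Fin.append_left v s i
    rw [this]; exact isDegLeFun_const 1 (v i)
  · have : (fun s : Fin m → Bool => Fin.append v s (Fin.natAdd k σ)) = fun s => s σ := by
      funext s; exact Fin.append_right v s σ
    rw [this]; exact isDegLeFun_apply σ le_rfl

/-- **Restrictions keep the degree**: `ρ_v = κ(v, ·)` has degree `≤ d` if `κ` has. [folklore] -/
theorem tc5_rho_isDegLeFun {d : ℕ} (κ : (Fin (k + m) → Bool) → Bool) (hκ : IsDegLeFun d κ) (v : Fin k → Bool) :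
    IsDegLeFun d (fun s : Fin m → Bool => κ (Fin.append v s)) :=
  knf_isDegLeFun_comp hκ _ fun l => tc5_append_coord_deg v l

/-- **All cells share the cubic form on the suffix.**  For `deg κ ≤ 3`, the third difference of `ρ_v` on unit vectors `e_σ, e_τ, e_υ` of
`𝔽₂ᵐ` (any base point) is the third difference of `κ` on `e_{k+σ}, e_{k+τ}, e_{k+υ}` (any base point) — independently of the cell `v`.
[this work] -/
theorem tc5_third_rho_unit (κ : (Fin (k + m) → Bool) → Bool) (hκ : IsDegLeFun 3 κ) (v : Fin k → Bool) (σ τ υ : Fin m)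
    (x : Fin m → Bool) (x' : Fin (k + m) → Bool) :
    let ρ : (Fin m → Bool) → Bool := fun s => κ (Fin.append v s)
    (((ρ x ^^ ρ (bxor x (fun l => decide (l = υ)))) ^^
          (ρ (bxor x (fun l => decide (l = τ))) ^^ ρ (bxor (bxor x (fun l => decide (l = τ))) (fun l => decide (l = υ))))) ^^
        ((ρ (bxor x (fun l => decide (l = σ))) ^^ ρ (bxor (bxor x (fun l => decide (l = σ))) (fun l => decide (l = υ)))) ^^
          (ρ (bxor (bxor x (fun l => decide (l = σ))) (fun l => decide (l = τ))) ^^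
            ρ (bxor (bxor (bxor x (fun l => decide (l = σ))) (fun l => decide (l = τ))) (fun l => decide (l = υ)))))) =
      (((κ x' ^^ κ (bxor x' (fun l => decide (l = Fin.natAdd k υ)))) ^^
          (κ (bxor x' (fun l => decide (l = Fin.natAdd k τ))) ^^
            κ (bxor (bxor x' (fun l => decide (l = Fin.natAdd k τ))) (fun l => decide (l = Fin.natAdd k υ))))) ^^
        ((κ (bxor x' (fun l => decide (l = Fin.natAdd k σ))) ^^
            κ (bxor (bxor x' (fun l => decide (l = Fin.natAdd k σ))) (fun l => decide (l = Fin.natAdd k υ)))) ^^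
          (κ (bxor (bxor x' (fun l => decide (l = Fin.natAdd k σ))) (fun l => decide (l = Fin.natAdd k τ))) ^^
            κ (bxor (bxor (bxor x' (fun l => decide (l = Fin.natAdd k σ))) (fun l => decide (l = Fin.natAdd k τ)))
              (fun l => decide (l = Fin.natAdd k υ)))))) := by
  intro ρ
  dsimp only [ρ]
  have e : ∀ (u : Fin m → Bool) (w : Fin m → Bool), bxor (Fin.append v w) (Fin.append zeroVec u) = Fin.append v (bxor w u) := by
    intro u w; rw [tc5_append_bxor, bxor_zeroVec]
  rw [← tcf_third_const κ hκ (fun l => decide (l = Fin.natAdd k σ)) (fun l => decide (l = Fin.natAdd k τ))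
    (fun l => decide (l = Fin.natAdd k υ)) (Fin.append v x) x', tc5_unit_right σ, tc5_unit_right τ, tc5_unit_right υ]
  simp only [e]

/-! ### The adapted R4 frame: prefix `(y_a, v₀, v₁, v₂, v₃)` with `κ(y) ⊕ κ(y ⊕ e₀) = y₁y₂ ⊕ y₃y₄` -/

section Adapted

variable (κ : (Fin (5 + m) → Bool) → Bool)
  (hD : ∀ y, (κ y ^^ κ (bxor y (fun l => decide (l = Fin.castAdd m (0 : Fin 5))))) =
    ((y (Fin.castAdd m (1 : Fin 5)) && y (Fin.castAdd m (2 : Fin 5))) ^^ (y (Fin.castAdd m (3 : Fin 5)) && y (Fin.castAdd m (4 : Fin 5)))))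
include hD

/-- In the adapted R4 frame the `y_a = 1` half of a cell is read off the `y_a = 0` half: `κ(1,v,s) = κ(0,v,s) ⊕ (v₀v₁ ⊕ v₂v₃)`.
[this work] -/
theorem tc5_top_half (v : Fin 4 → Bool) (s : Fin m → Bool) :
    κ (Fin.append (Matrix.vecCons true v) s) = (κ (Fin.append (Matrix.vecCons false v) s) ^^ ((v 0 && v 1) ^^ (v 2 && v 3))) := by
  have h := hD (Fin.append (Matrix.vecCons false v) s)
  rw [tc5_unit_left, tc5_append_bxor, bxor_zeroVec, Fin.append_left, Fin.append_left, Fin.append_left, Fin.append_left] at h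
  have hv : bxor (Matrix.vecCons false v) (fun l : Fin 5 => decide (l = 0)) = Matrix.vecCons true v := by
    funext l
    refine Fin.cases ?_ (fun i => ?_) l
    · simp [bxor]
    · simp only [bxor, Matrix.cons_val_succ]
      simp [Fin.succ_ne_zero]
  rw [hv] at h
  have h1 : (Matrix.vecCons false v : Fin 5 → Bool) 1 = v 0 := rfl
  have h2 : (Matrix.vecCons false v : Fin 5 → Bool) 2 = v 1 := rfl
  have h3 : (Matrix.vecCons false v : Fin 5 → Bool) 3 = v 2 := rfl
  have h4 : (Matrix.vecCons false v : Fin 5 → Bool) 4 = v 3 := rfl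
  rw [h1, h2, h3, h4] at h
  have key : ∀ A B C : Bool, (A ^^ B) = C → B = (A ^^ C) := by decide
  exact key _ _ _ h

/-- A cell of `Z₁₀` (`v₀v₁ ⊕ v₂v₃ = 0`): its two halves carry equally many ones. [this work] -/
theorem tc5_card_top_periodic (v : Fin 4 → Bool) (hv : ((v 0 && v 1) ^^ (v 2 && v 3)) = false) :
    #(univ.filter fun s : Fin m → Bool => κ (Fin.append (Matrix.vecCons true v) s) = true) =
      #(univ.filter fun s : Fin m → Bool => κ (Fin.append (Matrix.vecCons false v) s) = true) := by
  refine congrArg card (filter_congr fun s _ => ?_)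
  rw [tc5_top_half κ hD, hv, Bool.xor_false]

/-- A cell off `Z₁₀` (`v₀v₁ ⊕ v₂v₃ = 1`): its two halves carry `2ᵐ` ones together. [this work] -/
theorem tc5_card_top_special (v : Fin 4 → Bool) (hv : ((v 0 && v 1) ^^ (v 2 && v 3)) = true) :
    #(univ.filter fun s : Fin m → Bool => κ (Fin.append (Matrix.vecCons true v) s) = true) +
      #(univ.filter fun s : Fin m → Bool => κ (Fin.append (Matrix.vecCons false v) s) = true) = 2 ^ m := by
  have hc : (univ.filter fun s : Fin m → Bool => κ (Fin.append (Matrix.vecCons true v) s) = true) =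
      univ.filter fun s : Fin m → Bool => ¬ (κ (Fin.append (Matrix.vecCons false v) s) = true) := by
    refine filter_congr fun s _ => ?_
    rw [tc5_top_half κ hD, hv, Bool.xor_true]
    cases κ (Fin.append (Matrix.vecCons false v) s) <;> simp
  rw [hc, filter_not, card_sdiff_of_subset (filter_subset _ _), card_univ, Fintype.card_fun, Fintype.card_bool, Fintype.card_fin]
  have hle : #(univ.filter fun s : Fin m → Bool => κ (Fin.append (Matrix.vecCons false v) s) = true) ≤ 2 ^ m := by
    calc _ ≤ #(univ : Finset (Fin m → Bool)) := card_le_card (filter_subset _ _)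
      _ = 2 ^ m := by rw [card_univ, Fintype.card_fun, Fintype.card_bool, Fintype.card_fin]
  omega

/-- **The weight in an adapted R4 frame.**  `#κ = 6·2ᵐ + 2·Σ_{v ∈ Z₁₀} w(v)` with `w(v) = #{s : κ(0,v,s)}` and
`Z₁₀ = {v ∈ 𝔽₂⁴ : v₀v₁ = v₂v₃}` the ten cells `0000, 0001, 0010, 0100, 0101, 0110, 1000, 1001, 1010, 1111` (written `(v₀,v₁,v₂,v₃)`): each
of the six cells with `v₀v₁ ≠ v₂v₃` carries exactly `2ᵐ` ones, each cell of `Z₁₀` twice the weight of its restricted function.  (For `m = 7`: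
`wt κ = 768 + 2 Σ_{Z₁₀} wt f_v`, R4-PARTNER.md §1.) [this work] -/
theorem tc5_weight :
    #(univ.filter fun y : Fin (5 + m) → Bool => κ y = true) =
      6 * 2 ^ m + 2 * (#(univ.filter fun s : Fin m → Bool => κ (Fin.append ![false, false, false, false, false] s) = true) +
        #(univ.filter fun s : Fin m → Bool => κ (Fin.append ![false, false, false, false, true] s) = true) +
        #(univ.filter fun s : Fin m → Bool => κ (Fin.append ![false, false, false, true, false] s) = true) +
        #(univ.filter fun s : Fin m → Bool => κ (Fin.append ![false, false, true, false, false] s) = true) +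
        #(univ.filter fun s : Fin m → Bool => κ (Fin.append ![false, false, true, false, true] s) = true) +
        #(univ.filter fun s : Fin m → Bool => κ (Fin.append ![false, false, true, true, false] s) = true) +
        #(univ.filter fun s : Fin m → Bool => κ (Fin.append ![false, true, false, false, false] s) = true) +
        #(univ.filter fun s : Fin m → Bool => κ (Fin.append ![false, true, false, false, true] s) = true) +
        #(univ.filter fun s : Fin m → Bool => κ (Fin.append ![false, true, false, true, false] s) = true) +
        #(univ.filter fun s : Fin m → Bool => κ (Fin.append ![false, true, true, true, true] s) = true)) := by
  rw [tc5_card_cells]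
  -- the thirty-two half-cells
  have hsum : ∀ F : (Fin 5 → Bool) → ℕ, ∑ w : Fin 5 → Bool, F w =
      ∑ b : Bool, ∑ v₀ : Bool, ∑ v₁ : Bool, ∑ v₂ : Bool, ∑ v₃ : Bool, F ![b, v₀, v₁, v₂, v₃] := by
    intro F
    let e : (Fin 5 → Bool) ≃ Bool × Bool × Bool × Bool × Bool :=
      ⟨fun c => (c 0, c 1, c 2, c 3, c 4), fun t => ![t.1, t.2.1, t.2.2.1, t.2.2.2.1, t.2.2.2.2],
        fun c => by funext i; fin_cases i <;> rfl, fun t => rfl⟩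
    rw [Fintype.sum_equiv e F (fun t => F ![t.1, t.2.1, t.2.2.1, t.2.2.2.1, t.2.2.2.2]) (fun c => by
      show F c = F ![c 0, c 1, c 2, c 3, c 4]; congr 1; funext i; fin_cases i <;> rfl)]
    simp only [Fintype.sum_prod_type]
  rw [hsum]
  simp only [Fintype.sum_bool]
  have P := fun (v : Fin 4 → Bool) (h : ((v 0 && v 1) ^^ (v 2 && v 3)) = false) => tc5_card_top_periodic κ hD v h
  have S := fun (v : Fin 4 → Bool) (h : ((v 0 && v 1) ^^ (v 2 && v 3)) = true) => tc5_card_top_special κ hD v h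
  have p1 := P ![false, false, false, false] rfl
  have p2 := P ![false, false, false, true] rfl
  have p3 := P ![false, false, true, false] rfl
  have p4 := P ![false, true, false, false] rfl
  have p5 := P ![false, true, false, true] rfl
  have p6 := P ![false, true, true, false] rfl
  have p7 := P ![true, false, false, false] rfl
  have p8 := P ![true, false, false, true] rfl
  have p9 := P ![true, false, true, false] rfl
  have p10 := P ![true, true, true, true] rfl
  have s1 := S ![false, false, true, true] rfl
  have s2 := S ![false, true, true, true] rfl
  have s3 := S ![true, false, true, true] rfl
  have s4 := S ![true, true, false, false] rfl
  have s5 := S ![true, true, false, true] rfl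
  have s6 := S ![true, true, true, false] rfl
  omega

end Adapted

end Summit.QuantumAdvantage.QuantumAdvantage.Theorems.CubicForrelation.NearExactIsExact
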